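import Summits.BirchSwinnertonDyer.BirchSwinnertonDyer.Theorems.GenusKolyvaginAtTwoMinimalTwinBSDTwoKrizLiAnchorWall
import Summits.BirchSwinnertonDyer.BirchSwinnertonDyer.Theorems.ManinLocalTwoThreeBracketSturmOneEightyNineA
import Summits.BirchSwinnertonDyer.BirchSwinnertonDyer.Theorems.ByReductionTypeAtTwoAdditivePotGoodPrintKrizLi92b1Base
import Literature.NumberTheory.EllipticCurves.KrizLi2019.Table1RankOneRowsAdditiveAtThree
import Literature.NumberTheory.EllipticCurves.OrdinaryPrimesProofs
import Literature.NumberTheory.EllipticCurves.LeadingTermTamagawaProofs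
import Literature.NumberTheory.EllipticCurves.HeegnerHypothesisKroneckerProofs
import Literature.NumberTheory.QuadraticFields.KroneckerSplitting
import Mathlib.Tactic.NormNum.LegendreSymbol
import HarnessLib

/-!
# Route `GenusKolyvaginAtTwo`, crux U₂ `MinimalTwinBSDTwo` (stmt-BirchSwinnertonDyer-22985), LINE 23 «twin_swap»: THE WALL-KEYED KRIZ–LI ROAD AT THE
# RANK-ONE ANCHOR `189a1 = [0,0,1,-3,0]` (`y² + y = x³ − 3x`; `N = 189 = 3^3·7`, `Δ = 1701`, Kodaira `IV` at `3`, GOOD at `2`, `c₂ = 1`; Kriz–Li Table 1 row `189a1 | -47 | 1 | ✓`)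
# OVER `K = ℚ(√-47)` — kernel base data + `BSD(·, 2)` on the whole packet `{189a1^{(d)}, 189a1^{(-47d)} : d ∈ 𝒩(189a1, K), χ_d(−189) = 1}` from the
# PRINTED Table-1 row, Kriz–Li Thm 5.1 (2) / 4.3, Creutz–Miller on the base (`N = 189`) and WALL row 1 on the rank-zero companion `189a1^{(-47)}`
# (`N = 417501 > 5000`, outside Creutz–Miller); witness `d = 17`: members `189a1^{(17)}` (rank 1, `N = 54621`), `189a1^{(-799)}` (rank 0)

Seat `bsd-line-gk2-p2` g34 (PROVER 2/3, cell `bsd-f1-sign2`; LINE 23 holder), `--supports stmt-BirchSwinnertonDyer-22985` (helper; closes nothing).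
THEOREMS ONLY (0 `def`, 0 `sorry`); standard axioms.  HONEST FRAMING (D-0014/D-0036): instance of the base-generic wall-keyed road
`KrizLiAnchorWall.krizLi_bsdp_two_of_twist_of_conductor_lt_of_wall` (this seat, `…KrizLiAnchorWall.lean`) at `V = 189a1`.  CONDITIONAL on displayed
named facts: PRINT — Kriz–Li 2019 Thm 5.1 (2) (`thm112_bsdTwo_twist`), Thm 4.3 (`thm33_rank_twist`), the Table-1 row (`table1_row189a1`), Creutz–Miller /
Miller (`bsdTriple_of_analyticRank_le_one_of_conductor_lt` at `N = 189`), Gross–Zagier–Kolyvagin (`rank_eq_analyticRank_of_analyticRank_le_one`, for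
`r_an(189a1) = 1` from Thm 4.3 + the kernel point) — and the RESEARCH anchor S1′ = WALL row 1 (`BSD₂` for every non-CM curve of analytic rank `0`,
displayed as `hS1`; by name `Uniform.rankZeroBSDTwo_of_wallItems` from items 19095–19098), which pays the companion `189a1^{(-47)}` (non-CM,
`r_an = 0` by Thm 4.3).  Kernel (§1): global minimality, `E[2]` irreducible (the `2`-division cubic `X³ + (0)X² + (-48)X + (16)` has no root
mod `5`), good reduction at `2` with `c₂ = 1`, Kodaira `IV` at `3` by a Step2Cert certificate (`f_3 = 3`), non-CM (multiplicative at `7`), `N = 189 = 3^3·7` exactly, the point `7·P` of infinite order (denominator divisible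
by `5`), the Heegner hypothesis for `(189, -47)`, the witness `#Ẽ(𝔽_17) = 15` (`a_17` odd).
WHAT THIS SAYS FOR U₂: `rankOneMembers_189A1` — at every global minimal `W₁ ≅ 189a1^{(d)}`, `d ∈ 𝒩`, `χ_d(−189) = 1`: `r_an(W₁) = 1 ∧ ¬CM ∧ BSDp W₁ 2`
MODULO THE WALL + PRINT (no LINE 23 research stub); companions `r_an = 0 ∧ ¬CM ∧ BSDp`.  Beyond-print theorem: no.  **BSD is NOT proved by any of this;
U₂ is NOT proved; the wall is OPEN; no item is closed.**  References: [KrizLi2019] Thm 5.1 (2), Thm 4.3, Def 4.1, §6 Ex. 6.2, Table 1 (row 189a1,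
arXiv:1606.03172v3 Congruence.tex l. 996); [CreutzMiller2012] Thm 1.1; [Miller2011LMS] Def 1.1; [CremonaAlgorithms1997] Table 1 (189A1);
[SilvermanAEC2009] III.2.3, VII.1, VII.3.4, VII.5, X.5, App. C §11; [Kraus1989] Prop. 1–2; [Marcus1977] Ch. 3 Thm. 25.
-/

set_option autoImplicit false
-- the Theorems namespace of this sub repeats the summit name by design (D-0017 nested layout)
set_option linter.dupNamespace false

noncomputable section

open scoped Classical NumberField

open WeierstrassCurve IsDedekindDomain Rat.HeightOneSpectrum NumberField Literature.NumberTheory.EllipticCurves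
  Literature.NumberTheory.EllipticCurves.ModularForms
  Literature.NumberTheory.EllipticCurves.Rank1Residual
  Literature.NumberTheory.EllipticCurves.Rank1Residual.Typed
  Literature.NumberTheory.DiophantineGeometry
  Summit.BirchSwinnertonDyer
  Summit.BirchSwinnertonDyer.Rank1Residual
  Summit.BirchSwinnertonDyer.Rank1Residual.X11b
  Summit.BirchSwinnertonDyer.Rank1Residual.X5.O1
  Summit.BirchSwinnertonDyer.Rank1Residual.P2
  Summit.BirchSwinnertonDyer.BirchSwinnertonDyer.Rank1Residual.IntModel
  Summit.BirchSwinnertonDyer.BirchSwinnertonDyer.Theorems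
  Summit.BirchSwinnertonDyer.BirchSwinnertonDyer.Theorems.AddPotGoodPrint
  Summit.BirchSwinnertonDyer.BirchSwinnertonDyer.Theorems.GenusExact.TwinSwap.KrizLiAnchorWall
  Summit.BirchSwinnertonDyer.BirchSwinnertonDyer.Rank2Observatory.Tate

namespace Summit.BirchSwinnertonDyer.BirchSwinnertonDyer.Theorems.GenusExact.TwinSwap.KrizLiAnchor189a1

/-! ## §1 The anchor `189a1 = [0, 0, 1, -3, 0]`: `Δ = 1701`, `c₄ = 144`, GOOD at `2`, `IV` at `3`, multiplicative at `7` -/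
section Base189A1

/-- `Δ(189a1) = 1701` on the integer model. [cite: CremonaAlgorithms1997, Table 1 (189A1)] -/
theorem M189A1_Δ : (⟨0, 0, 1, -3, 0⟩ : WeierstrassCurve ℤ).Δ = 1701 := by decide +kernel
/-- `c₄(189a1) = 144` on the integer model. [cite: CremonaAlgorithms1997, Table 1 (189A1)] -/
theorem M189A1_c₄ : (⟨0, 0, 1, -3, 0⟩ : WeierstrassCurve ℤ).c₄ = 144 := by decide +kernel
/-- The integer model of `189a1` is Cremona's. [cite: SilvermanAEC2009, VIII.8] -/
theorem intModel_189A1 :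
    haveI := Summit.BirchSwinnertonDyer.BirchSwinnertonDyer.Theorems.ManinLocalTwoThree.LevelOneEightyNine.isElliptic_a; haveI := Summit.BirchSwinnertonDyer.BirchSwinnertonDyer.Theorems.ManinLocalTwoThree.LevelOneEightyNine.isGloballyMinimal_a
    integralModelInt (⟨0, 0, 1, -3, 0⟩ : WeierstrassCurve ℚ) = (⟨0, 0, 1, -3, 0⟩ : WeierstrassCurve ℤ) :=
  haveI := Summit.BirchSwinnertonDyer.BirchSwinnertonDyer.Theorems.ManinLocalTwoThree.LevelOneEightyNine.isElliptic_a; haveI := Summit.BirchSwinnertonDyer.BirchSwinnertonDyer.Theorems.ManinLocalTwoThree.LevelOneEightyNine.isGloballyMinimal_a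
  integralModelInt_eq_of_map_eq _ (by ext <;> simp [WeierstrassCurve.map])

/-- The integer model base-changed to `ℚ` is the rational model. [folklore] -/
theorem baseChange_int_189A1 : (⟨0, 0, 1, -3, 0⟩ : WeierstrassCurve ℤ).baseChange ℚ = (⟨0, 0, 1, -3, 0⟩ : WeierstrassCurve ℚ) := by
  ext <;> simp [WeierstrassCurve.baseChange, WeierstrassCurve.map]

/-- `b₂, b₄, b₆` of `189a1`. [cite: SilvermanAEC2009, III.1] -/
theorem b_189A1 : (⟨0, 0, 1, -3, 0⟩ : WeierstrassCurve ℚ).b₂ = ((0 : ℤ) : ℚ) ∧ (⟨0, 0, 1, -3, 0⟩ : WeierstrassCurve ℚ).b₄ = ((-6 : ℤ) : ℚ) ∧ (⟨0, 0, 1, -3, 0⟩ : WeierstrassCurve ℚ).b₆ = ((1 : ℤ) : ℚ) := by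
  simp only [WeierstrassCurve.b₂, WeierstrassCurve.b₄, WeierstrassCurve.b₆]; norm_num

/-- **`E[2]` irreducible for `189a1`** (`E(ℚ)[2] = 0`; Cremona `#T = 1`): the monic `2`-division cubic has no root modulo `5`.
[cite: SilvermanAEC2009, III.2.3 (b)] [cite: KrizLi2019, Thm. 5.1 (hypothesis E(ℚ)[2] = 0)] -/
theorem irr_two_189A1 :
    haveI := Summit.BirchSwinnertonDyer.BirchSwinnertonDyer.Theorems.ManinLocalTwoThree.LevelOneEightyNine.isElliptic_a
    Irr (⟨0, 0, 1, -3, 0⟩ : WeierstrassCurve ℚ) 2 :=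
  haveI := Summit.BirchSwinnertonDyer.BirchSwinnertonDyer.Theorems.ManinLocalTwoThree.LevelOneEightyNine.isElliptic_a
  irr_two_of_forall_cubic_ne _ b_189A1.1 b_189A1.2.1 b_189A1.2.2 (ℓ := 5) (by decide)

/-- **`E(ℚ)[2] = 0` for `189a1`** in Kriz–Li's shape. [cite: KrizLi2019, Thm. 5.1 hypothesis "E(ℚ)[2] = 0"] -/
theorem twoTorsion_189A1 :
    haveI := Summit.BirchSwinnertonDyer.BirchSwinnertonDyer.Theorems.ManinLocalTwoThree.LevelOneEightyNine.isElliptic_a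
    ∀ Q : (⟨0, 0, 1, -3, 0⟩ : WeierstrassCurve ℚ).toAffine.Point, 2 • Q = 0 → Q = 0 :=
  haveI := Summit.BirchSwinnertonDyer.BirchSwinnertonDyer.Theorems.ManinLocalTwoThree.LevelOneEightyNine.isElliptic_a
  (X5.O1.irr_two_iff_forall_two_nsmul _).mp irr_two_189A1

/-- **`189a1` has GOOD reduction at `2`** (`2 ∤ Δ_min = 1701`). [cite: SilvermanAEC2009, VII.5 Prop. 5.1 (a)] [cite: KrizLi2019, §6 Table 1 (row 189a1: c₂ = 1)] -/
theorem hasGoodReductionAtPrime_two_189A1 :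
    haveI := Summit.BirchSwinnertonDyer.BirchSwinnertonDyer.Theorems.ManinLocalTwoThree.LevelOneEightyNine.isGloballyMinimal_a; haveI : Fact (Nat.Prime 2) := ⟨Nat.prime_two⟩
    (⟨0, 0, 1, -3, 0⟩ : WeierstrassCurve ℚ).HasGoodReductionAtPrime 2 := by
  haveI := Summit.BirchSwinnertonDyer.BirchSwinnertonDyer.Theorems.ManinLocalTwoThree.LevelOneEightyNine.isElliptic_a; haveI := Summit.BirchSwinnertonDyer.BirchSwinnertonDyer.Theorems.ManinLocalTwoThree.LevelOneEightyNine.isGloballyMinimal_a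
  haveI : Fact (Nat.Prime 2) := ⟨Nat.prime_two⟩
  refine hasGoodReductionAtPrime_of_not_dvd _ 2 ?_
  rw [minimalDiscriminantInt_eq intModel_189A1, M189A1_Δ]; decide

/-- **`c₂(189a1) = 1`** (good reduction: Tate's Step 1). [cite: SilvermanAEC2009, VII.2 remark after Prop. 2.1] [cite: KrizLi2019, §6 Table 1 (row 189a1: c₂ = 1)] -/
theorem localTamagawaNumber_two_189A1 :
    haveI : Fact (Nat.Prime 2) := ⟨Nat.prime_two⟩
    ((⟨0, 0, 1, -3, 0⟩ : WeierstrassCurve ℚ).baseChange ℚ_[2]).localTamagawaNumber ℤ_[2] = 1 :=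
  haveI := Summit.BirchSwinnertonDyer.BirchSwinnertonDyer.Theorems.ManinLocalTwoThree.LevelOneEightyNine.isGloballyMinimal_a
  haveI : Fact (Nat.Prime 2) := ⟨Nat.prime_two⟩
  localTamagawaNumber_padic_eq_one_of_good_holds _ 2 hasGoodReductionAtPrime_two_189A1

/-- **Kriz–Li's local hypotheses at `2` for `189a1`**: `c₂ = 1` odd and the Manin-constant clause VOID (good at `2`), for ANY parametrisation datum.
[cite: KrizLi2019, Thm. 5.1 hypotheses "c₂(E) odd; Manin constant odd if additive at 2"] -/
theorem krizLi_loc_189A1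
    [haveI := Summit.BirchSwinnertonDyer.BirchSwinnertonDyer.Theorems.ManinLocalTwoThree.LevelOneEightyNine.isElliptic_a; NeZero ((⟨0, 0, 1, -3, 0⟩ : WeierstrassCurve ℚ).conductorNorm ℤ)]
    (Dt : haveI := Summit.BirchSwinnertonDyer.BirchSwinnertonDyer.Theorems.ManinLocalTwoThree.LevelOneEightyNine.isElliptic_a; ModularParametrizationData (⟨0, 0, 1, -3, 0⟩ : WeierstrassCurve ℚ) ((⟨0, 0, 1, -3, 0⟩ : WeierstrassCurve ℚ).conductorNorm ℤ)) :
    haveI := Summit.BirchSwinnertonDyer.BirchSwinnertonDyer.Theorems.ManinLocalTwoThree.LevelOneEightyNine.isElliptic_a; haveI : Fact (2 : ℕ).Prime := ⟨Nat.prime_two⟩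
    Odd (((⟨0, 0, 1, -3, 0⟩ : WeierstrassCurve ℚ).baseChange ℚ_[2]).localTamagawaNumber ℤ_[2]) ∧
      (¬ (⟨0, 0, 1, -3, 0⟩ : WeierstrassCurve ℚ).HasGoodReductionAtPrime 2 → ¬ (⟨0, 0, 1, -3, 0⟩ : WeierstrassCurve ℚ).HasMultiplicativeReductionAtPrime 2 → Odd Dt.c) :=
  ⟨by rw [localTamagawaNumber_two_189A1]; exact odd_one, fun h _ => absurd hasGoodReductionAtPrime_two_189A1 h⟩

/-- **`189a1` is non-CM**: multiplicative at `7` (`7 ∣ Δ`, `7 ∤ c₄ = 144`), so `ord_7 j < 0`. [cite: SilvermanAEC2009, App. C §11] -/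
theorem not_hasCM_189A1 :
    haveI := Summit.BirchSwinnertonDyer.BirchSwinnertonDyer.Theorems.ManinLocalTwoThree.LevelOneEightyNine.isElliptic_a
    ¬ (⟨0, 0, 1, -3, 0⟩ : WeierstrassCurve ℚ).HasCM := by
  haveI := Summit.BirchSwinnertonDyer.BirchSwinnertonDyer.Theorems.ManinLocalTwoThree.LevelOneEightyNine.isElliptic_a; haveI := Summit.BirchSwinnertonDyer.BirchSwinnertonDyer.Theorems.ManinLocalTwoThree.LevelOneEightyNine.isGloballyMinimal_a
  haveI : Fact (Nat.Prime 7) := ⟨by norm_num⟩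
  exact AdditivePotMult.not_hasCM_of_padicValRat_j_neg (p := 7) (EisensteinPrimes.padicValRat_j_neg_of_mult _ 7
    (hasMultiplicativeReductionAtPrime_of_intModel intModel_189A1 7 (by rw [M189A1_Δ]; decide) (by rw [M189A1_c₄]; decide)))

/-- **`1 ≤ rank_ℤ 189a1(ℚ)` IN THE KERNEL**: the rational point `7·P = (-4 / 25, 44 / 125)` has `5` in its denominator, so it has infinite order (kind `NL`,
Silverman VII.3.4, tree `one_le_mordellWeilRank_of_dvd_den`). [cite: SilvermanAEC2009, VII.3.4 and Thm. VIII.6.7] [cite: CremonaAlgorithms1997, Table 1 (189A1: r = 1)] -/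
theorem one_le_mordellWeilRank_189A1 :
    haveI := Summit.BirchSwinnertonDyer.BirchSwinnertonDyer.Theorems.ManinLocalTwoThree.LevelOneEightyNine.isElliptic_a; haveI := Summit.BirchSwinnertonDyer.BirchSwinnertonDyer.Theorems.ManinLocalTwoThree.LevelOneEightyNine.isGloballyMinimal_a
    1 ≤ (⟨0, 0, 1, -3, 0⟩ : WeierstrassCurve ℚ).mordellWeilRank :=
  haveI := Summit.BirchSwinnertonDyer.BirchSwinnertonDyer.Theorems.ManinLocalTwoThree.LevelOneEightyNine.isElliptic_a; haveI := Summit.BirchSwinnertonDyer.BirchSwinnertonDyer.Theorems.ManinLocalTwoThree.LevelOneEightyNine.isGloballyMinimal_a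
  haveI : Fact (Nat.Prime 5) := ⟨by norm_num⟩
  one_le_mordellWeilRank_of_dvd_den (⟨0, 0, 1, -3, 0⟩ : WeierstrassCurve ℚ) 5 (by norm_num) (x := -4 / 25) (y := 44 / 125)
    (WeierstrassCurve.Affine.equation_iff_nonsingular.mp (by rw [WeierstrassCurve.Affine.equation_iff]; norm_num))
    (by norm_num)

/-- **`N(189a1) ∣ |Δ_min| = 1701`.** [cite: SilvermanAEC2009, VIII.11 and C.16] -/
theorem conductorNorm_dvd_189A1 :
    haveI := Summit.BirchSwinnertonDyer.BirchSwinnertonDyer.Theorems.ManinLocalTwoThree.LevelOneEightyNine.isElliptic_a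
    (⟨0, 0, 1, -3, 0⟩ : WeierstrassCurve ℚ).conductorNorm ℤ ∣ 1701 := by
  haveI := Summit.BirchSwinnertonDyer.BirchSwinnertonDyer.Theorems.ManinLocalTwoThree.LevelOneEightyNine.isElliptic_a; haveI := Summit.BirchSwinnertonDyer.BirchSwinnertonDyer.Theorems.ManinLocalTwoThree.LevelOneEightyNine.isGloballyMinimal_a
  have hdvd := WeierstrassCurve.conductorNorm_dvd_minimalDiscriminantNorm (⟨0, 0, 1, -3, 0⟩ : WeierstrassCurve ℚ)
    (WeierstrassCurve.finite_setOf_ordMinimalDiscriminant_ne_zero_holds _)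
  rw [WeierstrassCurve.minimalDiscriminantNorm_int_eq_natAbs_minimalDiscriminantInt_holds,
    minimalDiscriminantInt_eq intModel_189A1, M189A1_Δ] at hdvd
  exact hdvd

/-- **Tate certificate for `189a1` at `3`, kernel check** (Steps 1–4): translate by `(r,s,t) = (-1,0,1)`; exit `4` — type `IV`,
`v_3(Δ) = 5`. [cite: Silverman1994, IV.9.4 Steps 1–4] -/
theorem tateStep2Check_3_189A1 : Step2Cert.check ⟨3, -1, 0, 1, 5, 4, 2⟩ ⟨0, 0, 1, -3, 0⟩ = true := by
  decide +kernel

/-- **`f_3(189a1) = 3`** (Ogg's formula from the certificate, hypothesis-free). [cite: Silverman1994, IV.11.1] -/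
theorem conductorExponent_3_189A1 (v : HeightOneSpectrum ℤ) (hv : natGenerator v = 3) :
    (⟨0, 0, 1, -3, 0⟩ : WeierstrassCurve ℚ).conductorExponent v = 3 := by
  have h := Step2Cert.conductorExponent_int_eq (W₀ := ⟨0, 0, 1, -3, 0⟩) (c := ⟨3, -1, 0, 1, 5, 4, 2⟩) v hv
    tateStep2Check_3_189A1
  rw [baseChange_int_189A1] at h
  exact h

/-- **`ord_3 N(189a1) = 3`, `ord_7 N(189a1) = 1`** (the latter: multiplicative at `7`, `7 ∣ Δ`, `7 ∤ c₄`). [cite: Silverman1994, IV.11.1] -/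
theorem factorization_conductorNorm_189A1 :
    haveI := Summit.BirchSwinnertonDyer.BirchSwinnertonDyer.Theorems.ManinLocalTwoThree.LevelOneEightyNine.isElliptic_a
    (((⟨0, 0, 1, -3, 0⟩ : WeierstrassCurve ℚ).conductorNorm ℤ).factorization 3 = 3) ∧ (((⟨0, 0, 1, -3, 0⟩ : WeierstrassCurve ℚ).conductorNorm ℤ).factorization 7 = 1) := by
  haveI := Summit.BirchSwinnertonDyer.BirchSwinnertonDyer.Theorems.ManinLocalTwoThree.LevelOneEightyNine.isElliptic_a; haveI := Summit.BirchSwinnertonDyer.BirchSwinnertonDyer.Theorems.ManinLocalTwoThree.LevelOneEightyNine.isGloballyMinimal_a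
  haveI hE : ((⟨0, 0, 1, -3, 0⟩ : WeierstrassCurve ℤ).baseChange ℚ).IsElliptic := by rw [baseChange_int_189A1]; infer_instance
  have hp : Nat.Prime 3 := by norm_num
  have hq : Nat.Prime 7 := by norm_num
  refine ⟨?_, ?_⟩
  · rw [show (3 : ℕ) = ((⟨3, hp⟩ : Nat.Primes) : ℕ) from rfl, factorization_conductorNorm_primesEquiv_symm]
    exact conductorExponent_3_189A1 _ (congrArg Subtype.val ((primesEquiv (R := ℤ)).apply_symm_apply ⟨3, hp⟩))
  · set v : HeightOneSpectrum ℤ := (primesEquiv (R := ℤ)).symm ⟨7, hq⟩ with hv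
    have hgen : natGenerator v = 7 := congrArg Subtype.val ((primesEquiv (R := ℤ)).apply_symm_apply ⟨7, hq⟩)
    have hmin : ((⟨0, 0, 1, -3, 0⟩ : WeierstrassCurve ℤ).baseChange ℚ).IsMinimalAt v := by
      rw [baseChange_int_189A1]; exact IsGloballyMinimal.isMinimalAt_int _ v
    have h1 : ((⟨0, 0, 1, -3, 0⟩ : WeierstrassCurve ℤ).baseChange ℚ).conductorExponent v = 1 :=
      conductorExponent_eq_one_of_dvd_Δ_of_not_dvd_c₄ hmin (by rw [hgen, M189A1_Δ]; decide) (by rw [hgen, M189A1_c₄]; decide)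
    rw [baseChange_int_189A1] at h1
    rw [show (7 : ℕ) = ((⟨7, hq⟩ : Nat.Primes) : ℕ) from rfl, factorization_conductorNorm_primesEquiv_symm]
    exact h1

/-- The prime factorisation of `3ᵃ·7ᵇ`, read coefficientwise. [folklore] -/
theorem factorization_3_pow_mul_7_pow_189A1 (a b r : ℕ) :
    (3 ^ a * 7 ^ b).factorization r = if r = 3 then a else if r = 7 then b else 0 := by
  have hp : Nat.Prime 3 := by norm_num
  have hq : Nat.Prime 7 := by norm_num
  rw [Nat.factorization_mul (pow_ne_zero _ hp.ne_zero) (pow_ne_zero _ hq.ne_zero), Finsupp.add_apply,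
    Nat.factorization_pow, Nat.factorization_pow, Finsupp.smul_apply, Finsupp.smul_apply, hp.factorization, hq.factorization,
    Finsupp.single_apply, Finsupp.single_apply]
  by_cases hrp : r = 3
  · subst hrp; simp
  by_cases hrq : r = 7
  · subst hrq; simp
  · simp [Ne.symm hrp, Ne.symm hrq, hrp, hrq]

/-- **`N(189a1) = 189 = 3^3·7` IN THE KERNEL** (`N ∣ 3^5·7^1`, `ord_3 N = 3`, `ord_7 N = 1`). [cite: CremonaAlgorithms1997, Table 1 (189A1)] -/
theorem conductorNorm_189A1 :
    haveI := Summit.BirchSwinnertonDyer.BirchSwinnertonDyer.Theorems.ManinLocalTwoThree.LevelOneEightyNine.isElliptic_a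
    (⟨0, 0, 1, -3, 0⟩ : WeierstrassCurve ℚ).conductorNorm ℤ = 189 := by
  haveI := Summit.BirchSwinnertonDyer.BirchSwinnertonDyer.Theorems.ManinLocalTwoThree.LevelOneEightyNine.isElliptic_a
  set N := (⟨0, 0, 1, -3, 0⟩ : WeierstrassCurve ℚ).conductorNorm ℤ with hN
  have hN0 : N ≠ 0 := (conductorNorm_pos_holds _).ne'
  obtain ⟨hp1, hq1⟩ := factorization_conductorNorm_189A1
  have hle := (Nat.factorization_le_iff_dvd hN0 (by norm_num : (1701 : ℕ) ≠ 0)).mpr conductorNorm_dvd_189A1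
  have eN : (189 : ℕ) = 3 ^ 3 * 7 ^ 1 := by norm_num
  have eΔ : (1701 : ℕ) = 3 ^ 5 * 7 ^ 1 := by norm_num
  refine Nat.eq_of_factorization_eq hN0 (by norm_num) fun r => ?_
  rw [eN, factorization_3_pow_mul_7_pow_189A1]
  by_cases hrp : r = 3
  · subst hrp; rw [hp1]; simp
  by_cases hrq : r = 7
  · subst hrq; rw [hq1]; simp
  have hr' := hle r
  rw [eΔ, factorization_3_pow_mul_7_pow_189A1, if_neg hrp, if_neg hrq] at hr'
  rw [if_neg hrp, if_neg hrq]
  exact Nat.le_zero.mp hr'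

/-- **`N(189a1) < 5000`** (Creutz–Miller's range). [cite: CreutzMiller2012, Thm. 1.1] -/
theorem conductorNorm_lt_5000_189A1 :
    haveI := Summit.BirchSwinnertonDyer.BirchSwinnertonDyer.Theorems.ManinLocalTwoThree.LevelOneEightyNine.isElliptic_a
    (⟨0, 0, 1, -3, 0⟩ : WeierstrassCurve ℚ).conductorNorm ℤ < 5000 := by
  rw [conductorNorm_189A1]; norm_num

/-- **The Heegner hypothesis for `(189a1, K)`, `d_K = -47`**: the primes `3`, `7` of `N = 189` split in `K` (`(-47/3) = (-47/7) = 1`).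
[cite: KrizLi2019, Thm. 5.1 hypothesis "K satisfies the Heegner hypothesis for N"] [cite: Marcus1977, Ch. 3 Thm. 25] -/
theorem satisfiesHeegnerHypothesis_189A1 {K : Type} [Field K] [NumberField K] (h2 : Module.finrank ℚ K = 2)
    (hdK : NumberField.discr K = -47) :
    haveI := Summit.BirchSwinnertonDyer.BirchSwinnertonDyer.Theorems.ManinLocalTwoThree.LevelOneEightyNine.isElliptic_a
    SatisfiesHeegnerHypothesis ((⟨0, 0, 1, -3, 0⟩ : WeierstrassCurve ℚ).conductorNorm ℤ) K := by
  rw [conductorNorm_189A1, satisfiesHeegnerHypothesis_iff_kronecker _ K h2, hdK]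
  intro r hr hrN
  have hrN' : r ∣ 3 ^ 3 * 7 := by norm_num at hrN ⊢; exact hrN
  rcases (Nat.Prime.dvd_mul hr).mp hrN' with h | h
  · obtain rfl := (Nat.prime_dvd_prime_iff_eq hr (by norm_num)).mp (hr.dvd_of_dvd_pow h)
    exact ⟨fun h => absurd h (by norm_num), fun _ => by norm_num⟩
  · obtain rfl := (Nat.prime_dvd_prime_iff_eq hr (by norm_num)).mp h
    exact ⟨fun h => absurd h (by norm_num), fun _ => by norm_num⟩

/-- **`#Ẽ(𝔽_17) = 15` for `189a1`** (certified count), so `a_17 = 3`. [cite: SilvermanAEC2009, V.2] -/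
theorem reductionPointCount_17_189A1 :
    haveI := Summit.BirchSwinnertonDyer.BirchSwinnertonDyer.Theorems.ManinLocalTwoThree.LevelOneEightyNine.isGloballyMinimal_a
    (⟨0, 0, 1, -3, 0⟩ : WeierstrassCurve ℚ).reductionPointCount 17 = 15 := by
  haveI : Fact (Nat.Prime 17) := ⟨by norm_num⟩
  haveI := Summit.BirchSwinnertonDyer.BirchSwinnertonDyer.Theorems.ManinLocalTwoThree.LevelOneEightyNine.isElliptic_a; haveI := Summit.BirchSwinnertonDyer.BirchSwinnertonDyer.Theorems.ManinLocalTwoThree.LevelOneEightyNine.isGloballyMinimal_a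
  exact Supersingular.reductionPointCount_eq_of_intModel_countPoints intModel_189A1 17 (by norm_num) (by decide +kernel)
    (by decide +kernel)

/-- **`a_17(189a1)` is odd** (`Frob_17` has order `3` on `E[2]`). [cite: KrizLi2019, Def. 4.1 ("Frob_ℓ of order 3")] -/
theorem odd_frobeniusTrace_17_189A1 :
    haveI := Summit.BirchSwinnertonDyer.BirchSwinnertonDyer.Theorems.ManinLocalTwoThree.LevelOneEightyNine.isGloballyMinimal_a
    Odd ((⟨0, 0, 1, -3, 0⟩ : WeierstrassCurve ℚ).frobeniusTrace 17) := by
  haveI := Summit.BirchSwinnertonDyer.BirchSwinnertonDyer.Theorems.ManinLocalTwoThree.LevelOneEightyNine.isGloballyMinimal_a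
  rw [Uniform.U2.odd_frobeniusTrace_iff_odd_reductionPointCount _ (by norm_num : Nat.Prime 17) (by norm_num),
    reductionPointCount_17_189A1]
  decide

end Base189A1

/-! ## §2 `r_an(189a1) = 1`; the wall-keyed road BY NAME from the Table-1 row; the U₂-keyed sorting -/
section Road189A1

/-- **`ord_{s=1} L(189a1, s) = 1`** granted Thm 4.3 (`h33`: `≤ 1` at `d = 1` over `ℚ(√-47)`), the Table-1 row (`htab`) and GZK (`hGZK`): the kernel point
`(-4 / 25, 44 / 125)` of infinite order rules out analytic rank `0`. [cite: KrizLi2019, Thm. 4.3 and §6 Table 1 (row 189a1)] [cite: CremonaAlgorithms1997, Table 1 (189A1: r = 1)] -/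
theorem analyticRank_189A1 (h33 : KrizLi2019.thm33_rank_twist) (htab : KrizLi2019.table1_row189a1)
    (hGZK : rank_eq_analyticRank_of_analyticRank_le_one) :
    haveI := Summit.BirchSwinnertonDyer.BirchSwinnertonDyer.Theorems.ManinLocalTwoThree.LevelOneEightyNine.isElliptic_a
    (⟨0, 0, 1, -3, 0⟩ : WeierstrassCurve ℚ).analyticRank = 1 := by
  haveI := Summit.BirchSwinnertonDyer.BirchSwinnertonDyer.Theorems.ManinLocalTwoThree.LevelOneEightyNine.isElliptic_a; haveI := Summit.BirchSwinnertonDyer.BirchSwinnertonDyer.Theorems.ManinLocalTwoThree.LevelOneEightyNine.isGloballyMinimal_a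
  haveI : Fact ((-47 : ℤ) < 0) := ⟨by norm_num⟩
  obtain ⟨hIQ, hdisc⟩ := P2.isImaginaryQuadratic_and_discr_of_sq_eq_neg_prime (sqrtField.finrank_eq_two (-47))
    (p := 47) (by norm_num) (by norm_num) (x := sqrtField.r (-47)) (by rw [sqrtField.r_sq']; push_cast; ring)
  obtain ⟨_, Dt, H, ι, P, j, -, hP, hstar⟩ := htab (sqrtField (-47)) hIQ hdisc
  have hle := krizLi_analyticRank_le_one _ h33 twoTorsion_189A1 (sqrtField (-47)) hIQ (satisfiesHeegnerHypothesis_189A1 hIQ.1 hdisc)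
    Dt H ι P hP j hstar
  have hrk := one_le_mordellWeilRank_189A1
  have h := (hGZK _ hle).1
  omega

/-- ★ **`BSD(W′, 2)` at EVERY global minimal `W′ ≅ 189a1^{(d)}` or `≅ 189a1^{(-47d)}`**, `d ∈ 𝒩(189a1, K)`, `χ_d(−189) = 1`, from the Table-1 row, PRINT, and
the WALL (S1′ displayed as `hS1`: `BSD₂` for every non-CM curve of analytic rank `0`).  [cite: KrizLi2019, Thm. 5.1 (2), Thm. 4.3, §6 Table 1 (row 189a1)]
[cite: CreutzMiller2012, Thm. 1.1] [cite: Miller2011LMS, Def. 1.1] -/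
theorem krizLi_bsdp_two_of_twist_189A1_of_wall (hKL : KrizLi2019.thm112_bsdTwo_twist) (h33 : KrizLi2019.thm33_rank_twist)
    (htab : KrizLi2019.table1_row189a1) (hS31 : bsdTriple_of_analyticRank_le_one_of_conductor_lt)
    (hGZK : rank_eq_analyticRank_of_analyticRank_le_one)
    (hS1 : ∀ (W : WeierstrassCurve ℚ) [W.IsElliptic] [W.IsGloballyMinimal], ¬ W.HasCM → W.analyticRank = 0 → BSDp W 2)
    (K : Type) [Field K] [NumberField K] (hK : IsImaginaryQuadratic K) (hdK : NumberField.discr K = -47)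
    {d : ℤ} (hd : haveI := Summit.BirchSwinnertonDyer.BirchSwinnertonDyer.Theorems.ManinLocalTwoThree.LevelOneEightyNine.isGloballyMinimal_a; KrizLi2019.InN (⟨0, 0, 1, -3, 0⟩ : WeierstrassCurve ℚ) K d)
    (hsign : haveI := Summit.BirchSwinnertonDyer.BirchSwinnertonDyer.Theorems.ManinLocalTwoThree.LevelOneEightyNine.isElliptic_a; Int.sign d * jacobiSym ((⟨0, 0, 1, -3, 0⟩ : WeierstrassCurve ℚ).conductorNorm ℤ) d.natAbs = 1)
    (W' : WeierstrassCurve ℚ) [W'.IsElliptic] [W'.IsGloballyMinimal]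
    (hW' : (∃ C : VariableChange ℚ, C • (⟨0, 0, 1, -3, 0⟩ : WeierstrassCurve ℚ).quadraticTwist (d : ℚ) = W') ∨
      (∃ C : VariableChange ℚ, C • (⟨0, 0, 1, -3, 0⟩ : WeierstrassCurve ℚ).quadraticTwist ((d * NumberField.discr K : ℤ) : ℚ) = W')) :
    BSDp W' 2 := by
  haveI := Summit.BirchSwinnertonDyer.BirchSwinnertonDyer.Theorems.ManinLocalTwoThree.LevelOneEightyNine.isElliptic_a; haveI := Summit.BirchSwinnertonDyer.BirchSwinnertonDyer.Theorems.ManinLocalTwoThree.LevelOneEightyNine.isGloballyMinimal_a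
  obtain ⟨_, Dt, H, ι, P, j, -, hP, hstar⟩ := htab K hK hdK
  exact krizLi_bsdp_two_of_twist_of_conductor_lt_of_wall _ hKL h33 hS31 hS1 conductorNorm_lt_5000_189A1 not_hasCM_189A1
    (analyticRank_189A1 h33 htab hGZK) twoTorsion_189A1 K hK (satisfiesHeegnerHypothesis_189A1 hK.1 hdK) Dt H ι P hP j hstar (krizLi_loc_189A1 Dt)
    hd hsign W' hW'

/-- **THE RANK-ONE MEMBERS `189a1^{(d)}` — U₂-CLASS CURVES SETTLED MODULO THE WALL + PRINT**: at every global minimal `W₁ ≅ 189a1^{(d)}` (`d ∈ 𝒩(189a1, K)`,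
`χ_d(−189) = 1`): `r_an(W₁) = 1 ∧ ¬CM ∧ BSD(W₁, 2)`.  BSD is not proved by any of this; U₂ is not proved.
[cite: KrizLi2019, Thm. 5.1 (2), Thm. 4.3, Thm. 1.4, §6 Table 1 (row 189a1)] [cite: CreutzMiller2012, Thm. 1.1] -/
theorem rankOneMembers_189A1 (hKL : KrizLi2019.thm112_bsdTwo_twist) (h33 : KrizLi2019.thm33_rank_twist)
    (htab : KrizLi2019.table1_row189a1) (hS31 : bsdTriple_of_analyticRank_le_one_of_conductor_lt)
    (hGZK : rank_eq_analyticRank_of_analyticRank_le_one)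
    (hS1 : ∀ (W : WeierstrassCurve ℚ) [W.IsElliptic] [W.IsGloballyMinimal], ¬ W.HasCM → W.analyticRank = 0 → BSDp W 2)
    (K : Type) [Field K] [NumberField K] (hK : IsImaginaryQuadratic K) (hdK : NumberField.discr K = -47)
    {d : ℤ} (hd : haveI := Summit.BirchSwinnertonDyer.BirchSwinnertonDyer.Theorems.ManinLocalTwoThree.LevelOneEightyNine.isGloballyMinimal_a; KrizLi2019.InN (⟨0, 0, 1, -3, 0⟩ : WeierstrassCurve ℚ) K d)
    (hsign : haveI := Summit.BirchSwinnertonDyer.BirchSwinnertonDyer.Theorems.ManinLocalTwoThree.LevelOneEightyNine.isElliptic_a; Int.sign d * jacobiSym ((⟨0, 0, 1, -3, 0⟩ : WeierstrassCurve ℚ).conductorNorm ℤ) d.natAbs = 1)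
    (W₁ : WeierstrassCurve ℚ) [W₁.IsElliptic] [W₁.IsGloballyMinimal]
    (hW₁ : ∃ C : VariableChange ℚ, C • (⟨0, 0, 1, -3, 0⟩ : WeierstrassCurve ℚ).quadraticTwist (d : ℚ) = W₁) :
    W₁.analyticRank = 1 ∧ ¬ W₁.HasCM ∧ BSDp W₁ 2 := by
  haveI := Summit.BirchSwinnertonDyer.BirchSwinnertonDyer.Theorems.ManinLocalTwoThree.LevelOneEightyNine.isElliptic_a; haveI := Summit.BirchSwinnertonDyer.BirchSwinnertonDyer.Theorems.ManinLocalTwoThree.LevelOneEightyNine.isGloballyMinimal_a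
  obtain ⟨_, Dt, H, ι, P, j, -, hP, hstar⟩ := htab K hK hdK
  exact rankOneMembers_of_wall _ hKL h33 hS31 hS1 conductorNorm_lt_5000_189A1 not_hasCM_189A1 (analyticRank_189A1 h33 htab hGZK) twoTorsion_189A1 K hK
    (satisfiesHeegnerHypothesis_189A1 hK.1 hdK) Dt H ι P hP j hstar (krizLi_loc_189A1 Dt) hd hsign W₁ hW₁

end Road189A1

/-! ## §3 The witness `ℓ = 17`: `a_17` odd, `17` splits in `ℚ(√-47)`, `d = 17 ≡ 1 (mod 4)`, `χ_{17}(−189) = 1` -/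
section Witness189A1

/-- **`ℓ ∈ 𝒮(189a1, K)`** from: `ℓ` prime, `ℓ ∉ {2, 3, 7}`, `(-47/ℓ) = 1`, `a_ℓ(189a1)` odd. [cite: KrizLi2019, Def. 4.1] [cite: Marcus1977, Ch. 3 Thm. 25] -/
theorem inS_189A1 {K : Type} [Field K] [NumberField K] (h2 : Module.finrank ℚ K = 2) (hdK : NumberField.discr K = -47)
    {ℓ : ℕ} (hℓ : ℓ.Prime) (hℓ2 : ℓ ≠ 2) (hℓp : ℓ ≠ 3) (hℓq : ℓ ≠ 7) (hj : jacobiSym (-47) ℓ = 1)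
    (hodd : haveI := Summit.BirchSwinnertonDyer.BirchSwinnertonDyer.Theorems.ManinLocalTwoThree.LevelOneEightyNine.isGloballyMinimal_a; Odd ((⟨0, 0, 1, -3, 0⟩ : WeierstrassCurve ℚ).frobeniusTrace ℓ)) :
    haveI := Summit.BirchSwinnertonDyer.BirchSwinnertonDyer.Theorems.ManinLocalTwoThree.LevelOneEightyNine.isGloballyMinimal_a
    KrizLi2019.InS (⟨0, 0, 1, -3, 0⟩ : WeierstrassCurve ℚ) K ℓ := by
  haveI := Summit.BirchSwinnertonDyer.BirchSwinnertonDyer.Theorems.ManinLocalTwoThree.LevelOneEightyNine.isElliptic_a; haveI := Summit.BirchSwinnertonDyer.BirchSwinnertonDyer.Theorems.ManinLocalTwoThree.LevelOneEightyNine.isGloballyMinimal_a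
  refine ⟨hℓ, ?_, ?_, hodd⟩
  · rw [conductorNorm_189A1]
    intro h
    have h' : ℓ ∣ 2 * (3 ^ 3 * 7) := by norm_num at h ⊢; exact h
    rcases (Nat.Prime.dvd_mul hℓ).mp h' with h | h
    · exact hℓ2 ((Nat.prime_dvd_prime_iff_eq hℓ Nat.prime_two).mp h)
    · rcases (Nat.Prime.dvd_mul hℓ).mp h with h | h
      · exact hℓp ((Nat.prime_dvd_prime_iff_eq hℓ (by norm_num)).mp (hℓ.dvd_of_dvd_pow h))
      · exact hℓq ((Nat.prime_dvd_prime_iff_eq hℓ (by norm_num)).mp h)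
  · rw [Literature.NumberTheory.QuadraticFields.Quadratic.ncard_primesOver_eq_two_iff_jacobiSym h2 hℓ hℓ2, hdK]
    exact hj

/-- **`17 ∈ 𝒩(189a1, K)`** (`d_K = -47`): `17 ≡ 1 (mod 4)`, `|17| = 17` prime `∉ {2, 3, 7}`, `(-47/17) = 1`, `a_17` odd. [cite: KrizLi2019, Def. 4.1] -/
theorem inN_witness_189A1 {K : Type} [Field K] [NumberField K] (h2 : Module.finrank ℚ K = 2) (hdK : NumberField.discr K = -47) :
    haveI := Summit.BirchSwinnertonDyer.BirchSwinnertonDyer.Theorems.ManinLocalTwoThree.LevelOneEightyNine.isGloballyMinimal_a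
    KrizLi2019.InN (⟨0, 0, 1, -3, 0⟩ : WeierstrassCurve ℚ) K (17) := by
  haveI := Summit.BirchSwinnertonDyer.BirchSwinnertonDyer.Theorems.ManinLocalTwoThree.LevelOneEightyNine.isGloballyMinimal_a
  have hw : Nat.Prime 17 := by norm_num
  have hna : (17 : ℤ).natAbs = 17 := rfl
  refine ⟨by decide, by rw [hna]; exact hw.squarefree, fun ℓ hℓ hℓd => ?_⟩
  rw [hna] at hℓd
  obtain rfl := (Nat.prime_dvd_prime_iff_eq hℓ hw).mp hℓd
  exact inS_189A1 h2 hdK hw (by norm_num) (by norm_num) (by norm_num) (by norm_num) odd_frobeniusTrace_17_189A1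

/-- **`χ_{17}(−189) = 1`**, read with `N = 189` exact. [cite: KrizLi2019, Thm. 5.1 (2) condition "χ_d(−N) = 1"] -/
theorem sign_witness_189A1 :
    haveI := Summit.BirchSwinnertonDyer.BirchSwinnertonDyer.Theorems.ManinLocalTwoThree.LevelOneEightyNine.isElliptic_a
    Int.sign (17) * jacobiSym ((⟨0, 0, 1, -3, 0⟩ : WeierstrassCurve ℚ).conductorNorm ℤ) (17 : ℤ).natAbs = 1 := by
  rw [conductorNorm_189A1, show (17 : ℤ).natAbs = 17 from rfl]; norm_num

/-- **The rank-one member `189a1^{(17)}`** (`N = 54621`): `r_an = 1 ∧ ¬CM ∧ BSD(·, 2)` at every global minimal model, modulo the WALL + PRINT — the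
`189a1` road is not vacuous on the U₂ side. BSD is not proved by any of this. [cite: KrizLi2019, Thm. 5.1 (2), Thm. 4.3, §6 Table 1 (row 189a1)] [cite: CreutzMiller2012, Thm. 1.1] -/
theorem rankOneMember_witness_189A1 (hKL : KrizLi2019.thm112_bsdTwo_twist) (h33 : KrizLi2019.thm33_rank_twist)
    (htab : KrizLi2019.table1_row189a1) (hS31 : bsdTriple_of_analyticRank_le_one_of_conductor_lt)
    (hGZK : rank_eq_analyticRank_of_analyticRank_le_one)
    (hS1 : ∀ (W : WeierstrassCurve ℚ) [W.IsElliptic] [W.IsGloballyMinimal], ¬ W.HasCM → W.analyticRank = 0 → BSDp W 2)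
    (K : Type) [Field K] [NumberField K] (hK : IsImaginaryQuadratic K) (hdK : NumberField.discr K = -47)
    (W₁ : WeierstrassCurve ℚ) [W₁.IsElliptic] [W₁.IsGloballyMinimal]
    (hW₁ : ∃ C : VariableChange ℚ, C • (⟨0, 0, 1, -3, 0⟩ : WeierstrassCurve ℚ).quadraticTwist ((17 : ℤ) : ℚ) = W₁) :
    W₁.analyticRank = 1 ∧ ¬ W₁.HasCM ∧ BSDp W₁ 2 :=
  rankOneMembers_189A1 hKL h33 htab hS31 hGZK hS1 K hK hdK (inN_witness_189A1 hK.1 hdK) sign_witness_189A1 W₁ hW₁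

end Witness189A1

end Summit.BirchSwinnertonDyer.BirchSwinnertonDyer.Theorems.GenusExact.TwinSwap.KrizLiAnchor189a1

end
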